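import Summits.ResolutionOfSingularities.ResolutionOfSingularities.Theorems.UniformComplexityCampaignW82TwistExponentRigidity
import Literature.AlgebraicGeometry.Resolution.ResolutionOfIsoLocus
import Literature.AlgebraicGeometry.Resolution.PrincipalizationToResolution
import Literature.AlgebraicGeometry.Resolution.ResolutionGlue
import Literature.AlgebraicGeometry.Resolution.SmoothStalksRegular
import Literature.AlgebraicGeometry.Resolution.SmoothOfRegularPerfectField
import Mathlib.AlgebraicGeometry.Morphisms.LocalFlatDescent
import Mathlib.AlgebraicGeometry.Morphisms.Proper
import HarnessLib

/-!
# [OURS · L1 W8.2] Separable tightness of resolution in families — the core: no model of a variety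
# containing Kollár's curve as an open is proper, an isomorphism over a non-empty open, and smooth

Cell `res-hironaka` (run/shared/lean/pub/res-hironaka/), LADDER-RESOLUTION rung L (RESCUE), slot W8.2, door 2
(`UniformComplexity`, host item `PrimeModelTransfer` stmt-ResolutionOfSingularities-8933); prover res-L1-s82-pv-2
(gen 7). THESES-FREE module (imports the gen-3 sibling `…TwistExponentRigidity` — `no_smooth_model_twistCurve` —
and tree files on resolutions / smoothness / descent, Mathlib, `HarnessLib`).

THE POINT (tightness of the family form `CampaignW82.FamilyResolution`, gen-6 census (a)). Resolution in
families asks, after a base extension `A → A'`, for ONE morphism `G : 𝒴 → 𝒳_{A'}` whose fibre over EVERY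
field-valued point of `Spec A'` is a weak resolution: proper, REGULAR source, isomorphism over a non-empty open.
Read at the two points `Spec (Frac A') → Spec A'` (generic) and `Spec (Frac A')^{alg} → Spec A'` (geometric
generic): the geometric generic fibre of `𝒴` is regular over an algebraically closed field, hence SMOOTH, hence —
smoothness descends along the fpqc cover `Spec (Frac A')^{alg} → Spec (Frac A')` — the generic fibre `𝒴_{K'}`
is SMOOTH over `K' = Frac A'`, and it is proper over `𝒳_{K'}` and an isomorphism over a non-empty open. If
`𝒳_{K'}` contains Kollár's curve `y^q = x^p − t` over `K'` as an open subscheme and `t` is not a `p`-th power in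
`K'` (which is what a SEPARABLE `A'` cannot repair), this is impossible. This file proves exactly these two steps,
over an arbitrary field, with no family in sight:

* `exists_isResolution_ι_comp` — from a proper `π : Z → Y` with `Z` regular locally Noetherian and `π` an
  isomorphism over a dense open: an open-and-closed `V ⊆ Z` with `V ↪ Z → Y` a resolution (the tree's
  `hasResolution_of_isIso_morphismRestrict`, exporting the piece `V` so that smoothness of `Z` passes to `V`).
* **`false_of_smooth_proper_isoOver`** — `K` of characteristic `p`, `X^p − t` irreducible over `K`, `q ≠ p`
  prime; `X'` an irreducible `K`-scheme with an open immersion `i : C_1 = {y^q = x^p − t} ↪ X'` over `K`;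
  `π : Y' → X'` proper and an isomorphism over a non-empty open, with `Y' → Spec K` SMOOTH ⟹ `False`
  (restrict the resolution piece over `i(C_1) ≅ C_1` and apply `TwistExponent.no_smooth_model_twistCurve`).
* `smooth_of_isRegular_pullback` — `g : Y → Spec K` locally of finite type whose base change to a PERFECT field
  `Ω ⊇ K` is regular is smooth (tree: regular + locally of finite type over perfect ⇒ smooth; Mathlib: `Smooth`
  descends along surjective flat quasi-compact morphisms, `Spec Ω → Spec K` being one).
* **`false_of_isRegular_pullback_proper_isoOver`** — the two combined: the form consumed by the family-level
  files (`…SeparableTightnessPencil`, `…SeparableTightness`).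

HONEST FRAMING. OURS negative-side bookkeeping for the campaign statement `CampaignW82.FamilyResolutionSep`
(sibling file, p554368); NOT a statement of H. Hironaka's 2017 manuscript ([Hironaka2017]); nothing here is
attributed to its author. AI work, weaker than expert review.

## References (vocabulary and locators only)
* J. Kollár, *Lectures on Resolution of Singularities* (2007), 1.19. [Kollar2007]
* The Stacks Project, Tags 056S (smooth over a field ⇒ regular), 00TV (regular over perfect ⇒ smooth),
  02VL (fpqc descent of smoothness). [StacksProject]
-/

noncomputable section

set_option linter.dupNamespace false -- mandated namespace of this single-conjunct summit

open Polynomial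
open _root_.CategoryTheory _root_.CategoryTheory.Limits _root_.AlgebraicGeometry _root_.TopologicalSpace
open Literature.AlgebraicGeometry.Resolution

namespace Summit.ResolutionOfSingularities.ResolutionOfSingularities.Theorems.CampaignW82.SeparableTightness

/-! ## §1 The resolution piece of a proper morphism that is an isomorphism over a dense open -/

/-- **The resolution piece.** A proper `π : Z → Y` from a regular locally Noetherian scheme which is an
isomorphism over a dense open `U ⊆ Y` restricts, on the open-and-closed subscheme `V = closure (π⁻¹ U)` of
`Z`, to a resolution of singularities `V ↪ Z → Y` (proper, birational, regular source). This is the tree's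
`hasResolution_of_isIso_morphismRestrict` with the piece `V` exported (so that further structure of `Z`, e.g.
smoothness over a field, is inherited by `V` through the open immersion `V.ι`). [cite: Kollar2007, Thm. 3.36] -/
theorem exists_isResolution_ι_comp {Z Y : Scheme.{0}} (π : Z ⟶ Y) [IsProper π] [IsLocallyNoetherian Z]
    (hZ : Scheme.IsRegular Z) (U : Y.Opens) (hU : Dense (U : Set Y)) (hiso : IsIso (π ∣_ U)) :
    ∃ V : Z.Opens, IsResolution (V.ι ≫ π) := by
  -- the clopen piece `V = closure (π⁻¹ U)`
  let V : Z.Opens := ⟨closure ((π ⁻¹ᵁ U : Z.Opens) : Set Z), hZ.isOpen_closure (π ⁻¹ᵁ U).isOpen⟩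
  have hle : π ⁻¹ᵁ U ≤ V := fun z hz => subset_closure hz
  haveI : IsClosedImmersion V.ι :=
    IsClosedImmersion.of_isPreimmersion V.ι (by rw [Scheme.Opens.range_ι]; exact isClosed_closure)
  refine ⟨V, ⟨inferInstance, ?_, hZ.of_isOpenImmersion V.ι⟩⟩
  refine ⟨U, hU, ?_, ?_⟩
  · -- `π⁻¹ U` is dense in its closure
    have hemb := V.ι.isOpenEmbedding
    have hpre : ((V.ι ≫ π) ⁻¹ᵁ U : Set V) = V.ι ⁻¹' ((π ⁻¹ᵁ U : Z.Opens) : Set Z) := rfl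
    rw [dense_iff_closure_eq, hpre, ← hemb.isOpenMap.preimage_closure_eq_closure_preimage
      V.ι.continuous]
    ext v
    simp only [Set.mem_preimage, Set.mem_univ, iff_true]
    exact v.2
  · -- over `U`: `(V.ι ≫ π)|_U = (V.ι|_{π⁻¹U}) ≫ π|_U` is an isomorphism
    rw [morphismRestrict_comp]
    have h1 : IsIso (V.ι ∣_ π ⁻¹ᵁ U) :=
      isIso_morphismRestrict_of_le_opensRange V.ι (π ⁻¹ᵁ U)
        (by rw [Scheme.Opens.opensRange_ι]; exact hle)
    exact @IsIso.comp_isIso _ _ _ _ _ _ _ h1 hiso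

/-! ## §2 No smooth proper model, isomorphic over a non-empty open, of a variety containing Kollár's curve -/

section Core

variable (K : Type) [Field K] (p : ℕ) (t : K) (q : ℕ)

/-- **Core of the separable tightness.** Let `K` have characteristic `p`, `X^p − t` be irreducible over `K`
(`t ∉ K^p`) and `q ≠ p` be prime. Let `X'` be an IRREDUCIBLE `K`-scheme containing Kollár's curve
`C_1 = Spec K[x,y]/(y^q − (x^p − t))` as an open subscheme over `K` (`i ≫ g = ` structure morphism of `C_1`).
Then there is NO `π : Y' → X'` which is proper, an isomorphism over a non-empty open `W ⊆ X'`, and whose source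
is SMOOTH over `K`. Proof: `Y'` is regular (smooth over a field) and locally Noetherian, `W` is dense, so the
resolution piece `V ↪ Y' → X'` (`exists_isResolution_ι_comp`) is a resolution; restricted over the open
`i(C_1) ≅ C_1` it is a proper birational `V' → C_1` (`IsBirational.morphismRestrict`, `IsBirational.comp_iso`)
whose source, an open subscheme of `Y'`, is smooth over `K` — contradicting
`TwistExponent.no_smooth_model_twistCurve` (`N = 1`). [cite: Kollar2007, 1.19] -/
theorem false_of_smooth_proper_isoOver [Fact p.Prime] [CharP K p] [Fact q.Prime] (hqp : q ≠ p)
    (ht : Irreducible (X ^ p - C t : K[X]))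
    {X' Y' : Scheme.{0}} (g : X' ⟶ Spec (.of K)) [IrreducibleSpace X']
    (i : TwistExponent.twistCurve K p t q 1 ⟶ X') [IsOpenImmersion i]
    (hi : i ≫ g = TwistExponent.twistCurveTo K p t q 1)
    (π : Y' ⟶ X') [IsProper π] (W : X'.Opens) (hW : (W : Set X').Nonempty) (hiso : IsIso (π ∣_ W))
    [hsm : Smooth (π ≫ g)] : False := by
  -- `Y'` is regular and locally Noetherian, `W` is dense
  have hreg : Scheme.IsRegular Y' := fun y => isRegularLocalRing_stalk_of_smooth_of_field (π ≫ g) y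
  haveI : IsLocallyNoetherian Y' := LocallyOfFiniteType.isLocallyNoetherian (π ≫ g)
  have hWd : Dense (W : Set X') := W.2.dense hW
  -- the resolution piece `ρ = V.ι ≫ π`
  obtain ⟨V, hres⟩ := exists_isResolution_ι_comp π hreg W hWd hiso
  haveI := hres.isProper
  -- restrict over the open `i(C_1) ≅ C_1`
  let U : X'.Opens := i.opensRange
  have hbirU : IsBirational ((V.ι ≫ π) ∣_ U) := hres.isBirational.morphismRestrict U
  let e : TwistExponent.twistCurve K p t q 1 ≅ (U : Scheme.{0}) := i.isoOpensRange
  let ρ' : ↑((V.ι ≫ π) ⁻¹ᵁ U) ⟶ TwistExponent.twistCurve K p t q 1 := ((V.ι ≫ π) ∣_ U) ≫ e.inv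
  have hbir' : IsBirational ρ' := hbirU.comp_iso e.inv
  -- the source of `ρ'` is smooth over `K`
  have hfac : ρ' ≫ TwistExponent.twistCurveTo K p t q 1 = ((V.ι ≫ π) ⁻¹ᵁ U).ι ≫ V.ι ≫ π ≫ g := by
    rw [← hi]
    change ((V.ι ≫ π) ∣_ U) ≫ e.inv ≫ i ≫ g = _
    rw [show e.inv ≫ i ≫ g = U.ι ≫ g by rw [← Category.assoc, i.isoOpensRange_inv_comp]]
    rw [← Category.assoc, morphismRestrict_ι, Category.assoc, Category.assoc]
  haveI : Smooth (ρ' ≫ TwistExponent.twistCurveTo K p t q 1) := by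
    rw [hfac]
    haveI : Smooth (V.ι ≫ π ≫ g) := inferInstance
    infer_instance
  exact TwistExponent.no_smooth_model_twistCurve K p t q hqp ht one_pos (Nat.coprime_one_right q) _ ρ' hbir'

end Core

/-! ## §3 Smoothness from regularity of the base change to a perfect field -/

/-- `Spec Ω → Spec K` for a ring map of fields is surjective, flat and quasi-compact (an fpqc cover of the
point). [folklore] -/
theorem surjective_flat_quasiCompact_specMap_of_field {K Ω : Type} [Field K] [Field Ω] (φ : K →+* Ω) :
    (@Surjective ⊓ @Flat ⊓ @QuasiCompact : MorphismProperty Scheme.{0}) (Spec.map (CommRingCat.ofHom φ)) := by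
  refine ⟨⟨⟨fun x => ⟨default, Subsingleton.elim _ _⟩⟩, ?_⟩, inferInstance⟩
  have hflat : φ.Flat := by
    algebraize [φ]
    change Module.Flat K Ω
    infer_instance
  exact (HasRingHomProperty.Spec_iff (P := @Flat)).mpr hflat

/-- **Regular geometric fibre ⇒ smooth.** If `g : Y → Spec K` is locally of finite type and the base change
`Y ×_K Spec Ω` along a ring map of fields `φ : K → Ω` with `Ω` PERFECT is a regular scheme, then `g` is smooth:
`Y_Ω → Spec Ω` is locally of finite type with regular source, hence smooth (tree,
`smooth_of_isRegular_of_perfectField`, Stacks 00TV), and smoothness descends along the surjective flat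
quasi-compact `Spec Ω → Spec K` (Mathlib, `DescendsAlong @Smooth (@Surjective ⊓ @Flat ⊓ @QuasiCompact)`,
Stacks 02VL). [cite: StacksProject, Tag 02VL] -/
theorem smooth_of_isRegular_pullback {Y : Scheme.{0}} {K Ω : Type} [Field K] [Field Ω] [PerfectField Ω]
    (φ : K →+* Ω) (g : Y ⟶ Spec (.of K)) [LocallyOfFiniteType g]
    (hreg : Scheme.IsRegular (pullback g (Spec.map (CommRingCat.ofHom φ)))) : Smooth g := by
  have hsm : Smooth (pullback.snd g (Spec.map (CommRingCat.ofHom φ))) :=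
    smooth_of_isRegular_of_perfectField _ hreg
  exact MorphismProperty.of_pullback_snd_of_descendsAlong (P := @Smooth)
    (Q := (@Surjective ⊓ @Flat ⊓ @QuasiCompact : MorphismProperty Scheme.{0}))
    (surjective_flat_quasiCompact_specMap_of_field φ) hsm

/-! ## §4 The two fibres combined -/

section Combined

variable (K : Type) [Field K] (p : ℕ) (t : K) (q : ℕ)

/-- **Separable tightness, scheme level.** `K` of characteristic `p` with `X^p − t` irreducible, `q ≠ p`
prime, `φ : K → Ω` a ring map to a PERFECT field; `X'` an irreducible `K`-scheme containing Kollár's curve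
`C_1 : y^q = x^p − t` as an open subscheme over `K`; `π : Y' → X'` proper, an isomorphism over a non-empty open,
with `Y' → Spec K` locally of finite type. If the base change `Y' ×_K Spec Ω` is REGULAR, contradiction: by
`smooth_of_isRegular_pullback` `Y'` is smooth over `K`, and `false_of_smooth_proper_isoOver` applies. In the
family setting: `π` = the fibre of `G : 𝒴 → 𝒳_{A'}` over the generic point `Spec (Frac A')`, `Ω` = an algebraic
closure of `Frac A'`, and regularity of `Y'_Ω` = «the geometric generic fibre of `G` is a weak resolution».
[cite: Kollar2007, 1.19] -/
theorem false_of_isRegular_pullback_proper_isoOver [Fact p.Prime] [CharP K p] [Fact q.Prime] (hqp : q ≠ p)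
    (ht : Irreducible (X ^ p - C t : K[X])) {Ω : Type} [Field Ω] [PerfectField Ω] (φ : K →+* Ω)
    {X' Y' : Scheme.{0}} (g : X' ⟶ Spec (.of K)) [IrreducibleSpace X']
    (i : TwistExponent.twistCurve K p t q 1 ⟶ X') [IsOpenImmersion i]
    (hi : i ≫ g = TwistExponent.twistCurveTo K p t q 1)
    (π : Y' ⟶ X') [IsProper π] (W : X'.Opens) (hW : (W : Set X').Nonempty) (hiso : IsIso (π ∣_ W))
    [LocallyOfFiniteType (π ≫ g)]
    (hreg : Scheme.IsRegular (pullback (π ≫ g) (Spec.map (CommRingCat.ofHom φ)))) : False := by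
  haveI : Smooth (π ≫ g) := smooth_of_isRegular_pullback φ (π ≫ g) hreg
  exact false_of_smooth_proper_isoOver K p t q hqp ht g i hi π W hW hiso

end Combined

end Summit.ResolutionOfSingularities.ResolutionOfSingularities.Theorems.CampaignW82.SeparableTightness

end
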